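import Summits.MatrixMultiplication.MatrixMultiplication.Theorems.ObstructionDescentUniversalOccurrenceTwoRectangleOddHookTableaux

set_option linter.dupNamespace false
set_option autoImplicit false

/-!
# Universal occurrence — two rectangles and the shape `(2N-7,3,3,1)`, part A: the tableau (decomp-mm · lens 3 · gen 46)

Route `route-MatrixMultiplication-ObstructionDescent` (sub-problem `MatrixMultiplication`, `ω(ℂ) = 2`); SUPPORT for the crux
`NoOccurrenceObstruction` (`P_O`, item `stmt-MatrixMultiplication-29040`) through the universal-occurrence programme (NODE-g29…g46
of the decomp-mm cell, lens 3).  Nothing here proves `ω = 2` or closes an item; no `def`, no `sorry`, standard axioms.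

**Why.**  The kernels of parts IX–XIV (floor law, storey law, odd hook, `(2N-5,3,1,1)`, the four-odd class, blow-ups) leave the
third legs `ν = (2N-7,3,3,1)` — the first family with TWO columns of height `3` next to the column of height `4` — as the
smallest open local pattern of the injection census (I265, patterns `ab31`).  The design of part C (`…ThreeThreeOne`) feeds its
third-leg words to the polytabloid `e_T` of the standard tableau `T″` of `(2N-7,3,3,1)` whose column `0` sits on positions
`0,1,2,3`, column `1` on `4,5,6`, column `2` on `7,8,9` and whose arm (row `0`, columns `≥ 3`) sits on positions `≥ 10`.
This file isolates the tableau side, exactly as part A of the odd hook (`…OddHookTableaux`) did for one column.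

**Contents.**  §1: the cells of `T″` (`threeThreeOneCell_*`, `mem_youngDiagram_threeThreeOne`).  §2: support of `e_T` — a word
`u` with `e_T(u) ≠ 0` vanishes on the arm and reads injectively letters `< 4` down column `0` and letters `< 3` down columns `1, 2`
(`threeThreeOneTableau_support`).  §3: value — `e_T(u) = sgn π₀ · sgn π₁ · sgn π₂` for the three column readings
(`threeThreeOneTableau_apply_eq_sign`, via `extendDomain`), the parity form of `sgn` on `S_3` (`sign_perm_fin_three_eq`), and the
column-flip rule `e_T(w ∘ π) = -e_T(w)` for the position involution `π` exchanging `2↔3, 4↔5, 8↔9` and the two blocks along the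
arm (`threeThreeOneTableau_comp_flip`) — the involution that cancels the "toggling" words of part C.

[cite: BurgisserIkenmeyer2011, Thm. 4.4, Lemma 6.1] [cite: BurgisserIkenmeyer2017, §5, Thm. 5.9 (proof of (2)), eq. (3.4)]
-/

noncomputable section

open scoped BigOperators

namespace Summit.MatrixMultiplication.MatrixMultiplication.Theorems.ObstructionCalculus

open Literature.Computability.AlgebraicComplexity
open Literature.NumberTheory.DiophantineGeometry

/-! ### §1 The tableau `T″`: column `0` on positions `0..3`, column `1` on `4..6`, column `2` on `7..9`, then the arm -/

/-- Cells of `T″` are distinct. [folklore] -/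
theorem threeThreeOneCell_injective {p q : ℕ}
    (hpq : (if p < 4 then (p, 0) else if p < 10 then ((p - 4) % 3, (p - 4) / 3 + 1) else (0, p - 7) : ℕ × ℕ) =
      (if q < 4 then (q, 0) else if q < 10 then ((q - 4) % 3, (q - 4) / 3 + 1) else (0, q - 7))) : p = q := by
  split_ifs at hpq <;> simp only [Prod.mk.injEq] at hpq <;> omega

/-- `T″` is a standard filling for the position order. [folklore] -/
theorem threeThreeOneCell_standard {p q : ℕ} (hpq : p < q) :
    ¬ ((if q < 4 then (q, 0) else if q < 10 then ((q - 4) % 3, (q - 4) / 3 + 1) else (0, q - 7) : ℕ × ℕ) ≤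
      (if p < 4 then (p, 0) else if p < 10 then ((p - 4) % 3, (p - 4) / 3 + 1) else (0, p - 7))) := by
  split_ifs <;> simp only [Prod.mk_le_mk] <;> omega

/-- The Young diagram of `(2N-7,3,3,1)`: its boxes. [folklore] -/
theorem mem_youngDiagram_threeThreeOne {N : ℕ} (ν : Nat.Partition (N * 2)) (hν : ν.sortedParts = [2 * N - 7, 3, 3, 1])
    {r c : ℕ} (h : (r = 0 ∧ c < 2 * N - 7) ∨ (1 ≤ r ∧ r < 3 ∧ c < 3) ∨ (r = 3 ∧ c = 0)) : (r, c) ∈ ν.youngDiagram := by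
  rw [Nat.Partition.mem_youngDiagram_iff, hν]
  rcases h with ⟨rfl, hc⟩ | ⟨hr1, hr3, hc⟩ | ⟨rfl, rfl⟩
  · exact ⟨by simp, by simpa using hc⟩
  · have hr : r = 1 ∨ r = 2 := by omega
    rcases hr with rfl | rfl <;> exact ⟨by simp, by simpa using hc⟩
  · exact ⟨by simp, by simp⟩

/-- `(2N-7,3,3,1)` has four rows. [folklore] -/
theorem fst_lt_of_mem_youngDiagram_threeThreeOne {N : ℕ} (ν : Nat.Partition (N * 2))
    (hν : ν.sortedParts = [2 * N - 7, 3, 3, 1]) {x : ℕ × ℕ} (hx : x ∈ ν.youngDiagram.cells) : x.1 < 4 := by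
  obtain ⟨h, -⟩ := (Nat.Partition.mem_youngDiagram_iff ν x).1 ((YoungDiagram.mem_cells _).1 hx)
  rw [hν] at h
  simpa using h

/-- The cells of `T″` lie in `(2N-7,3,3,1)` (`5 ≤ N`). [folklore] -/
theorem threeThreeOneCell_mem {N : ℕ} (hN : 5 ≤ N) (ν : Nat.Partition (N * 2)) (hν : ν.sortedParts = [2 * N - 7, 3, 3, 1])
    (p : ℕ) (hp : p < N * 2) :
    (if p < 4 then (p, 0) else if p < 10 then ((p - 4) % 3, (p - 4) / 3 + 1) else (0, p - 7) : ℕ × ℕ) ∈ ν.youngDiagram := by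
  split_ifs with h1 h2 <;> apply mem_youngDiagram_threeThreeOne ν hν
  · rcases Nat.eq_zero_or_pos p with rfl | hp0
    · left; constructor <;> omega
    · by_cases hp3 : p = 3
      · right; right; exact ⟨hp3, rfl⟩
      · right; left; refine ⟨?_, ?_, ?_⟩ <;> omega
  · rcases Nat.eq_zero_or_pos ((p - 4) % 3) with h0 | hpos
    · left; constructor <;> omega
    · right; left; refine ⟨?_, ?_, ?_⟩ <;> omega
  · left; constructor <;> omega

/-! ### §2 Support of the polytabloid `e_T` -/

/-- **Support of `e_T`.**  If `e_T(u) ≠ 0` then `u` vanishes on the arm, reads letters `< 4` injectively down column `0`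
(positions `0..3`) and letters `< 3` injectively down column `1` (positions `4..6`) and column `2` (positions `7..9`). [folklore] -/
theorem threeThreeOneTableau_support {N : ℕ} {Y : YoungDiagram} (hN : ∀ x ∈ Y.cells, x.1 < N) (T : StdFilling (N * 2) Y)
    (hT : ∀ p : Fin (N * 2), T.1 p = (if (p : ℕ) < 4 then ((p : ℕ), 0)
      else if (p : ℕ) < 10 then (((p : ℕ) - 4) % 3, ((p : ℕ) - 4) / 3 + 1) else (0, (p : ℕ) - 7)))
    {u : Word N (N * 2)} (hu : T.polytabloid ℂ hN u ≠ 0) :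
    (∀ p : Fin (N * 2), 10 ≤ (p : ℕ) → ((u p : Fin N) : ℕ) = 0) ∧
    (∀ p : Fin (N * 2), (p : ℕ) < 4 → ((u p : Fin N) : ℕ) < 4) ∧
    (∀ p : Fin (N * 2), 4 ≤ (p : ℕ) → (p : ℕ) < 10 → ((u p : Fin N) : ℕ) < 3) ∧
    (∀ p q : Fin (N * 2), (p : ℕ) < 4 → (q : ℕ) < 4 → u p = u q → p = q) ∧
    (∀ p q : Fin (N * 2), 4 ≤ (p : ℕ) → (p : ℕ) < 7 → 4 ≤ (q : ℕ) → (q : ℕ) < 7 → u p = u q → p = q) ∧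
    (∀ p q : Fin (N * 2), 7 ≤ (p : ℕ) → (p : ℕ) < 10 → 7 ≤ (q : ℕ) → (q : ℕ) < 10 → u p = u q → p = q) := by
  classical
  obtain ⟨σ, hσ, rfl⟩ := StdFilling.exists_of_polytabloid_apply_ne_zero hN T hu
  have hcol : ∀ p, (T.1 (σ p)).2 = (T.1 p).2 := StdFilling.mem_colStab.1 hσ
  have hval : ∀ p, ((StdFilling.rowWord hN T ∘ ⇑σ) p : ℕ) = (T.1 (σ p)).1 := fun p => rfl
  have hrow' : ∀ q : Fin (N * 2), (T.1 q).1 =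
      if (q : ℕ) < 4 then (q : ℕ) else if (q : ℕ) < 10 then ((q : ℕ) - 4) % 3 else 0 := fun q => by
    rw [hT]; split_ifs <;> rfl
  have hcol' : ∀ q : Fin (N * 2), (T.1 q).2 =
      if (q : ℕ) < 4 then 0 else if (q : ℕ) < 10 then ((q : ℕ) - 4) / 3 + 1 else (q : ℕ) - 7 := fun q => by
    rw [hT]; split_ifs <;> rfl
  -- two positions of one column with the same letter coincide
  have key : ∀ p q : Fin (N * 2), (T.1 p).2 = (T.1 q).2 →
      (StdFilling.rowWord hN T ∘ ⇑σ) p = (StdFilling.rowWord hN T ∘ ⇑σ) q → p = q := by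
    intro p q hpq huv
    have hr : (T.1 (σ p)).1 = (T.1 (σ q)).1 := by
      rw [← hval, ← hval]; exact congrArg Fin.val huv
    have hc : (T.1 (σ p)).2 = (T.1 (σ q)).2 := by rw [hcol, hcol, hpq]
    exact σ.injective (T.injective (Prod.ext hr hc))
  refine ⟨fun p hp => ?_, fun p hp => ?_, fun p hp hp' => ?_, fun p q hp hq => key p q ?_,
    fun p q hp hp' hq hq' => key p q ?_, fun p q hp hp' hq hq' => key p q ?_⟩
  · have hc := hcol p
    rw [hcol', hcol'] at hc
    rw [hval, hrow']
    split_ifs at hc ⊢ <;> omega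
  · have hc := hcol p
    rw [hcol', hcol'] at hc
    rw [hval, hrow']
    split_ifs at hc ⊢ <;> omega
  · have hc := hcol p
    rw [hcol', hcol'] at hc
    rw [hval, hrow']
    split_ifs at hc ⊢ <;> omega
  all_goals rw [hcol', hcol']; split_ifs <;> omega

/-! ### §3 Value of `e_T`: three column signs, the parity form on `S_3`, and the column flip -/

/-- **Value of `e_T` on a support word.**  If `u` vanishes on the arm and `π₀ ∈ S_4`, `π₁, π₂ ∈ S_3` read the three columns
(`π₀(i) = u(i)`, `π₁(i) = u(i+4)`, `π₂(i) = u(i+7)`), then `e_T(u) = sgn π₀ · sgn π₁ · sgn π₂`: `u = w_T ∘ ρ` for the column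
permutation `ρ = π₀ π₁ π₂` (each extended by the identity), and `e_T(w_T ∘ ρ) = sgn ρ`. [folklore] -/
theorem threeThreeOneTableau_apply_eq_sign {N : ℕ} {Y : YoungDiagram} (hN : ∀ x ∈ Y.cells, x.1 < N)
    (T : StdFilling (N * 2) Y)
    (hT : ∀ p : Fin (N * 2), T.1 p = (if (p : ℕ) < 4 then ((p : ℕ), 0)
      else if (p : ℕ) < 10 then (((p : ℕ) - 4) % 3, ((p : ℕ) - 4) / 3 + 1) else (0, (p : ℕ) - 7)))
    (h10 : 10 ≤ N * 2) {u : Word N (N * 2)} (harm : ∀ p : Fin (N * 2), 10 ≤ (p : ℕ) → ((u p : Fin N) : ℕ) = 0)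
    (π₀ : Equiv.Perm (Fin 4)) (hπ₀ : ∀ i : Fin 4, ((π₀ i : Fin 4) : ℕ) = ((u ⟨i, by omega⟩ : Fin N) : ℕ))
    (π₁ : Equiv.Perm (Fin 3)) (hπ₁ : ∀ i : Fin 3, ((π₁ i : Fin 3) : ℕ) = ((u ⟨(i : ℕ) + 4, by omega⟩ : Fin N) : ℕ))
    (π₂ : Equiv.Perm (Fin 3)) (hπ₂ : ∀ i : Fin 3, ((π₂ i : Fin 3) : ℕ) = ((u ⟨(i : ℕ) + 7, by omega⟩ : Fin N) : ℕ)) :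
    T.polytabloid ℂ hN u =
      ((Equiv.Perm.sign π₀ : ℤ) : ℂ) * ((Equiv.Perm.sign π₁ : ℤ) : ℂ) * ((Equiv.Perm.sign π₂ : ℤ) : ℂ) := by
  classical
  let f₀ : Fin 4 ≃ {p : Fin (N * 2) // (p : ℕ) < 4} :=
    { toFun := fun i => ⟨⟨i, by omega⟩, i.2⟩
      invFun := fun p => ⟨p.1, p.2⟩
      left_inv := fun i => Fin.ext rfl
      right_inv := fun p => Subtype.ext (Fin.ext rfl) }
  let f₁ : Fin 3 ≃ {p : Fin (N * 2) // 4 ≤ (p : ℕ) ∧ (p : ℕ) < 7} :=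
    { toFun := fun i => ⟨⟨(i : ℕ) + 4, by omega⟩, ⟨by simp, by simp; omega⟩⟩
      invFun := fun p => ⟨(p.1 : ℕ) - 4, by have := p.2; omega⟩
      left_inv := fun i => Fin.ext (by simp)
      right_inv := fun p => Subtype.ext (Fin.ext (by have := p.2; simp; omega)) }
  let f₂ : Fin 3 ≃ {p : Fin (N * 2) // 7 ≤ (p : ℕ) ∧ (p : ℕ) < 10} :=
    { toFun := fun i => ⟨⟨(i : ℕ) + 7, by omega⟩, ⟨by simp, by simp; omega⟩⟩
      invFun := fun p => ⟨(p.1 : ℕ) - 7, by have := p.2; omega⟩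
      left_inv := fun i => Fin.ext (by simp)
      right_inv := fun p => Subtype.ext (Fin.ext (by have := p.2; simp; omega)) }
  obtain ⟨E₀, hE₀⟩ : ∃ E : Equiv.Perm (Fin (N * 2)), E = π₀.extendDomain f₀ := ⟨_, rfl⟩
  obtain ⟨E₁, hE₁⟩ : ∃ E : Equiv.Perm (Fin (N * 2)), E = π₁.extendDomain f₁ := ⟨_, rfl⟩
  obtain ⟨E₂, hE₂⟩ : ∃ E : Equiv.Perm (Fin (N * 2)), E = π₂.extendDomain f₂ := ⟨_, rfl⟩
  have hE₀_in : ∀ (p : Fin (N * 2)) (hp : (p : ℕ) < 4), ((E₀ p : Fin (N * 2)) : ℕ) = ((π₀ ⟨p, hp⟩ : Fin 4) : ℕ) := by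
    intro p hp; rw [hE₀, Equiv.Perm.extendDomain_apply_subtype π₀ f₀ hp]; rfl
  have hE₀_out : ∀ p : Fin (N * 2), ¬ (p : ℕ) < 4 → E₀ p = p := fun p hp => by
    rw [hE₀]; exact Equiv.Perm.extendDomain_apply_not_subtype π₀ f₀ hp
  have hE₁_in : ∀ (p : Fin (N * 2)) (hp : 4 ≤ (p : ℕ) ∧ (p : ℕ) < 7),
      ((E₁ p : Fin (N * 2)) : ℕ) = ((π₁ ⟨(p : ℕ) - 4, by omega⟩ : Fin 3) : ℕ) + 4 := by
    intro p hp; rw [hE₁, Equiv.Perm.extendDomain_apply_subtype π₁ f₁ hp]; rfl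
  have hE₁_out : ∀ p : Fin (N * 2), ¬ (4 ≤ (p : ℕ) ∧ (p : ℕ) < 7) → E₁ p = p := fun p hp => by
    rw [hE₁]; exact Equiv.Perm.extendDomain_apply_not_subtype π₁ f₁ hp
  have hE₂_in : ∀ (p : Fin (N * 2)) (hp : 7 ≤ (p : ℕ) ∧ (p : ℕ) < 10),
      ((E₂ p : Fin (N * 2)) : ℕ) = ((π₂ ⟨(p : ℕ) - 7, by omega⟩ : Fin 3) : ℕ) + 7 := by
    intro p hp; rw [hE₂, Equiv.Perm.extendDomain_apply_subtype π₂ f₂ hp]; rfl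
  have hE₂_out : ∀ p : Fin (N * 2), ¬ (7 ≤ (p : ℕ) ∧ (p : ℕ) < 10) → E₂ p = p := fun p hp => by
    rw [hE₂]; exact Equiv.Perm.extendDomain_apply_not_subtype π₂ f₂ hp
  obtain ⟨ρ, hρ⟩ : ∃ ρ : Equiv.Perm (Fin (N * 2)), ρ = E₀ * E₁ * E₂ := ⟨_, rfl⟩
  -- the values of `ρ` on the four regions
  have hρ0 : ∀ (p : Fin (N * 2)) (hp : (p : ℕ) < 4), ((ρ p : Fin (N * 2)) : ℕ) = ((π₀ ⟨p, hp⟩ : Fin 4) : ℕ) := by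
    intro p hp
    rw [hρ, Equiv.Perm.mul_apply, Equiv.Perm.mul_apply, hE₂_out p (by omega), hE₁_out p (by omega), hE₀_in p hp]
  have hρ1 : ∀ (p : Fin (N * 2)) (hp : 4 ≤ (p : ℕ) ∧ (p : ℕ) < 7),
      ((ρ p : Fin (N * 2)) : ℕ) = ((π₁ ⟨(p : ℕ) - 4, by omega⟩ : Fin 3) : ℕ) + 4 := by
    intro p hp
    have h1 := hE₁_in p hp
    have hq : ¬ ((E₁ p : Fin (N * 2)) : ℕ) < 4 := by rw [h1]; omega
    rw [hρ, Equiv.Perm.mul_apply, Equiv.Perm.mul_apply, hE₂_out p (by omega), hE₀_out _ hq, h1]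
  have hρ2 : ∀ (p : Fin (N * 2)) (hp : 7 ≤ (p : ℕ) ∧ (p : ℕ) < 10),
      ((ρ p : Fin (N * 2)) : ℕ) = ((π₂ ⟨(p : ℕ) - 7, by omega⟩ : Fin 3) : ℕ) + 7 := by
    intro p hp
    have h2 := hE₂_in p hp
    have hb := (π₂ ⟨(p : ℕ) - 7, by omega⟩).2
    have hq1 : ¬ (4 ≤ ((E₂ p : Fin (N * 2)) : ℕ) ∧ ((E₂ p : Fin (N * 2)) : ℕ) < 7) := by rw [h2]; omega
    have hq0 : ¬ ((E₂ p : Fin (N * 2)) : ℕ) < 4 := by rw [h2]; omega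
    rw [hρ, Equiv.Perm.mul_apply, Equiv.Perm.mul_apply, hE₁_out _ hq1, hE₀_out _ hq0, h2]
  have hρ3 : ∀ p : Fin (N * 2), 10 ≤ (p : ℕ) → ρ p = p := fun p hp => by
    rw [hρ, Equiv.Perm.mul_apply, Equiv.Perm.mul_apply, hE₂_out p (by omega), hE₁_out p (by omega),
      hE₀_out p (by omega)]
  have hreg : ∀ p : Fin (N * 2), ((p : ℕ) < 4 ∧ ((ρ p : Fin (N * 2)) : ℕ) < 4) ∨
      (4 ≤ (p : ℕ) ∧ (p : ℕ) < 7 ∧ 4 ≤ ((ρ p : Fin (N * 2)) : ℕ) ∧ ((ρ p : Fin (N * 2)) : ℕ) < 7) ∨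
      (7 ≤ (p : ℕ) ∧ (p : ℕ) < 10 ∧ 7 ≤ ((ρ p : Fin (N * 2)) : ℕ) ∧ ((ρ p : Fin (N * 2)) : ℕ) < 10) ∨
      (10 ≤ (p : ℕ) ∧ ((ρ p : Fin (N * 2)) : ℕ) = (p : ℕ)) := by
    intro p
    by_cases h0 : (p : ℕ) < 4
    · left; refine ⟨h0, ?_⟩; rw [hρ0 p h0]; exact (π₀ _).2
    by_cases h1 : (p : ℕ) < 7
    · right; left; have h := hρ1 p ⟨by omega, h1⟩; have hb := (π₁ ⟨(p : ℕ) - 4, by omega⟩).2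
      refine ⟨by omega, h1, ?_, ?_⟩ <;> omega
    by_cases h2 : (p : ℕ) < 10
    · right; right; left; have h := hρ2 p ⟨by omega, h2⟩; have hb := (π₂ ⟨(p : ℕ) - 7, by omega⟩).2
      refine ⟨by omega, h2, ?_, ?_⟩ <;> omega
    · right; right; right; exact ⟨by omega, congrArg Fin.val (hρ3 p (by omega))⟩
  have hcol' : ∀ q : Fin (N * 2), (T.1 q).2 =
      if (q : ℕ) < 4 then 0 else if (q : ℕ) < 10 then ((q : ℕ) - 4) / 3 + 1 else (q : ℕ) - 7 := fun q => by
    rw [hT]; split_ifs <;> rfl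
  have hrow' : ∀ q : Fin (N * 2), (T.1 q).1 =
      if (q : ℕ) < 4 then (q : ℕ) else if (q : ℕ) < 10 then ((q : ℕ) - 4) % 3 else 0 := fun q => by
    rw [hT]; split_ifs <;> rfl
  have hρcol : ρ ∈ T.colStab := StdFilling.mem_colStab.2 fun p => by
    rw [hcol', hcol']
    rcases hreg p with h | h | h | h <;> split_ifs <;> omega
  have hu : u = T.rowWord hN ∘ ⇑ρ := by
    funext p
    apply Fin.ext
    show ((u p : Fin N) : ℕ) = (T.1 (ρ p)).1
    rw [hrow']
    by_cases h0 : (p : ℕ) < 4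
    · rw [hρ0 p h0, if_pos (π₀ _).2, hπ₀]
    by_cases h1 : (p : ℕ) < 7
    · have hb := (π₁ ⟨(p : ℕ) - 4, by omega⟩).2
      rw [hρ1 p ⟨by omega, h1⟩, if_neg (by omega), if_pos (by omega), Nat.add_sub_cancel, Nat.mod_eq_of_lt hb, hπ₁]
      exact congrArg (fun q : Fin (N * 2) => ((u q : Fin N) : ℕ)) (Fin.ext (by simp; omega))
    by_cases h2 : (p : ℕ) < 10
    · have hb := (π₂ ⟨(p : ℕ) - 7, by omega⟩).2
      rw [hρ2 p ⟨by omega, h2⟩, if_neg (by omega), if_pos (by omega),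
        show ((π₂ ⟨(p : ℕ) - 7, by omega⟩ : Fin 3) : ℕ) + 7 - 4 = ((π₂ ⟨(p : ℕ) - 7, by omega⟩ : Fin 3) : ℕ) + 3 * 1
          by omega, Nat.add_mul_mod_self_left, Nat.mod_eq_of_lt hb, hπ₂]
      exact congrArg (fun q : Fin (N * 2) => ((u q : Fin N) : ℕ)) (Fin.ext (by simp; omega))
    · rw [congrArg Fin.val (hρ3 p (by omega)), if_neg h0, if_neg h2]
      exact harm p (by omega)
  have h := congrFun (StdFilling.wordPerm_polytabloid_of_mem_colStab (k := ℂ) hN T hρcol) (T.rowWord hN)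
  rw [wordPerm_apply, Pi.smul_apply, smul_eq_mul, StdFilling.polytabloid_apply_rowWord, mul_one] at h
  rw [hu, h, hρ, Equiv.Perm.sign_mul, Equiv.Perm.sign_mul, Units.val_mul, Units.val_mul, Int.cast_mul, Int.cast_mul,
    hE₀, hE₁, hE₂, Equiv.Perm.sign_extendDomain, Equiv.Perm.sign_extendDomain, Equiv.Perm.sign_extendDomain]

set_option maxHeartbeats 400000 in
/-- The sign of a permutation of `{0,1,2}` is the parity of its three inversions (checked by `decide`). [folklore] -/
theorem sign_perm_fin_three_eq (π : Equiv.Perm (Fin 3)) : ((Equiv.Perm.sign π : ℤ) : ℂ) =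
    if ((if ((π 1 : Fin 3) : ℕ) < ((π 0 : Fin 3) : ℕ) then 1 else 0) + (if ((π 2 : Fin 3) : ℕ) < ((π 0 : Fin 3) : ℕ) then 1 else 0) +
        (if ((π 2 : Fin 3) : ℕ) < ((π 1 : Fin 3) : ℕ) then 1 else 0)) % 2 = 0
    then 1 else -1 := by
  have key : ∀ τ : Equiv.Perm (Fin 3), ((Equiv.Perm.sign τ : ℤˣ) : ℤ) =
      if ((if ((τ 1 : Fin 3) : ℕ) < ((τ 0 : Fin 3) : ℕ) then 1 else 0) + (if ((τ 2 : Fin 3) : ℕ) < ((τ 0 : Fin 3) : ℕ) then 1 else 0) +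
          (if ((τ 2 : Fin 3) : ℕ) < ((τ 1 : Fin 3) : ℕ) then 1 else 0)) % 2 = 0
      then 1 else -1 := by
    decide
  rw [key π]
  split_ifs <;> simp

/-- **Column flip.**  Let `π` be the position involution exchanging `2↔3` (column `0`, rows `2,3`), `4↔5` (column `1`, rows
`0,1`), `8↔9` (column `2`, rows `1,2`), fixing `0,1,6,7`, and exchanging `2s ↔ 2s+1` along the arm (`s ≥ 5`).  Then
`e_T(w ∘ π) = -e_T(w)` for EVERY word `w`: if `w` vanishes on the arm, `w ∘ π = w ∘ π_c` for the odd column permutation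
`π_c = (2 3)(4 5)(8 9) ∈ C(T″)`; otherwise both sides vanish. [folklore] -/
theorem threeThreeOneTableau_comp_flip {N : ℕ} {Y : YoungDiagram} (hN : ∀ x ∈ Y.cells, x.1 < N)
    (T : StdFilling (N * 2) Y)
    (hT : ∀ p : Fin (N * 2), T.1 p = (if (p : ℕ) < 4 then ((p : ℕ), 0)
      else if (p : ℕ) < 10 then (((p : ℕ) - 4) % 3, ((p : ℕ) - 4) / 3 + 1) else (0, (p : ℕ) - 7)))
    (h10 : 10 ≤ N * 2) (π : Equiv.Perm (Fin (N * 2)))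
    (hπ : ∀ q : Fin (N * 2), ((π q : Fin (N * 2)) : ℕ) =
      if (q : ℕ) = 2 then 3 else if (q : ℕ) = 3 then 2 else if (q : ℕ) = 4 then 5 else if (q : ℕ) = 5 then 4
      else if (q : ℕ) = 8 then 9 else if (q : ℕ) = 9 then 8 else if (q : ℕ) < 10 then (q : ℕ)
      else if (q : ℕ) % 2 = 0 then (q : ℕ) + 1 else (q : ℕ) - 1)
    (w : Word N (N * 2)) : T.polytabloid ℂ hN (w ∘ ⇑π) = - T.polytabloid ℂ hN w := by
  classical
  have hcol' : ∀ q : Fin (N * 2), (T.1 q).2 =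
      if (q : ℕ) < 4 then 0 else if (q : ℕ) < 10 then ((q : ℕ) - 4) / 3 + 1 else (q : ℕ) - 7 := fun q => by
    rw [hT]; split_ifs <;> rfl
  by_cases harm : ∀ p : Fin (N * 2), 10 ≤ (p : ℕ) → ((w p : Fin N) : ℕ) = 0
  · obtain ⟨πc, hπc⟩ : ∃ ρ : Equiv.Perm (Fin (N * 2)), ρ = Equiv.swap (⟨2, by omega⟩ : Fin (N * 2)) ⟨3, by omega⟩ *
        (Equiv.swap (⟨4, by omega⟩ : Fin (N * 2)) ⟨5, by omega⟩ * Equiv.swap (⟨8, by omega⟩ : Fin (N * 2)) ⟨9, by omega⟩) :=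
      ⟨_, rfl⟩
    have hπc_col : πc ∈ T.colStab := by
      rw [hπc]
      refine StdFilling.mul_mem_colStab (StdFilling.swap_mem_colStab ?_)
        (StdFilling.mul_mem_colStab (StdFilling.swap_mem_colStab ?_) (StdFilling.swap_mem_colStab ?_)) <;>
        (rw [hcol', hcol']; norm_num)
    have hw : w ∘ ⇑π = w ∘ ⇑πc := by
      funext q
      show w (π q) = w (πc q)
      by_cases hq : (q : ℕ) < 10
      · have hv : ((π q : Fin (N * 2)) : ℕ) = ((πc q : Fin (N * 2)) : ℕ) := by
          rw [hπ, hπc]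
          simp only [Equiv.Perm.mul_apply, Equiv.swap_apply_def, Fin.ext_iff]
          have hq' : (q : ℕ) = 0 ∨ (q : ℕ) = 1 ∨ (q : ℕ) = 2 ∨ (q : ℕ) = 3 ∨ (q : ℕ) = 4 ∨ (q : ℕ) = 5 ∨ (q : ℕ) = 6 ∨
              (q : ℕ) = 7 ∨ (q : ℕ) = 8 ∨ (q : ℕ) = 9 := by omega
          rcases hq' with h | h | h | h | h | h | h | h | h | h <;> simp [h]
        rw [Fin.ext hv]
      · have hπq : 10 ≤ ((π q : Fin (N * 2)) : ℕ) := by rw [hπ]; split_ifs <;> omega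
        have hne : ∀ (k : ℕ) (hk : k < N * 2), k < 10 → q ≠ ⟨k, hk⟩ := fun k hk hk10 h =>
          hq (by rw [h]; exact hk10)
        have hcq : πc q = q := by
          rw [hπc, Equiv.Perm.mul_apply, Equiv.Perm.mul_apply,
            Equiv.swap_apply_of_ne_of_ne (hne 8 (by omega) (by omega)) (hne 9 (by omega) (by omega)),
            Equiv.swap_apply_of_ne_of_ne (hne 4 (by omega) (by omega)) (hne 5 (by omega) (by omega)),
            Equiv.swap_apply_of_ne_of_ne (hne 2 (by omega) (by omega)) (hne 3 (by omega) (by omega))]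
        rw [hcq]
        exact Fin.ext (by rw [harm _ hπq, harm q (by omega)])
    have h := congrFun (StdFilling.wordPerm_polytabloid_of_mem_colStab (k := ℂ) hN T hπc_col) w
    rw [wordPerm_apply, Pi.smul_apply, smul_eq_mul] at h
    have hsgn : ((Equiv.Perm.sign πc : ℤ) : ℂ) = -1 := by
      rw [hπc, Equiv.Perm.sign_mul, Equiv.Perm.sign_mul, Equiv.Perm.sign_swap, Equiv.Perm.sign_swap,
        Equiv.Perm.sign_swap] <;> simp
    rw [hw, h, hsgn, neg_one_mul]
  · push Not at harm
    obtain ⟨p, hp, hwp⟩ := harm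
    have h1 : T.polytabloid ℂ hN w = 0 := by
      by_contra h
      exact hwp ((threeThreeOneTableau_support hN T hT h).1 p hp)
    have h2 : T.polytabloid ℂ hN (w ∘ ⇑π) = 0 := by
      by_contra h
      have hp' : 10 ≤ ((π.symm p : Fin (N * 2)) : ℕ) := by
        by_contra hlt
        have hv := hπ (π.symm p)
        rw [Equiv.apply_symm_apply] at hv
        split_ifs at hv <;> omega
      have h0 := (threeThreeOneTableau_support hN T hT h).1 (π.symm p) hp'
      simp only [Function.comp_apply, Equiv.apply_symm_apply] at h0
      exact hwp h0
    rw [h1, h2, neg_zero]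

end Summit.MatrixMultiplication.MatrixMultiplication.Theorems.ObstructionCalculus

end
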